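import Literature.AlgebraicTopology.SingularHomology.RelativeCochainsKronecker
import HarnessLib

/-!
# Kronecker duality for pairs, cyclic case: `Hₘ₊₁(X, A; R)` cyclic and `Hₘ(X, A; R)` projective
# imply `Hᵐ⁺¹(X, A; R)` cyclic

A. Hatcher, *Algebraic Topology* (2002), §3.1, Thm. 3.2 (p. 195; p. 197 over a principal ideal
domain) applied to the relative chain complex `C(X, A)` (p. 199: "which is free with basis the
singular simplices of `X` not in `A`"): `Hᵐ⁺¹(X, A; R) ≅ Hom_R(Hₘ₊₁(X, A), R) ⊕ Ext_R(Hₘ(X, A), R)`,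
whose second summand vanishes when `Hₘ(X, A)` is projective. Consequently, if moreover
`Hₘ₊₁(X, A; R)` is generated by one element `θ`, then `Hᵐ⁺¹(X, A; R) ≅ Hom_R(R θ, R)` is generated by
one element as well. This file PROVES that consequence in the tree's model — relative function
cochains `relCochains` / `relSingularCohomology` (`RelativeCochains.lean`) and the concrete relative
homology `H(C(X)/C(A))` (`chainsInSub`, `relZ`, `relClsₗ` of `RelativeCochainsKronecker.lean`) —
from the two directions of Kronecker duality already in the tree,
`exists_relCocycle_of_linearMap` (every functional on `Hₘ₊₁(X, A)` is a relative cocycle) and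
`exists_rel_d_eq_of_kill` (a relative cocycle killing the relative cycles is a relative coboundary,
`Hₘ(X, A)` projective):

* `exists_linearMap_of_relCocycle` — the functional `[x] ↦ φ(x)` on `Hₙ(C(X)/C(A))` of a relative
  cocycle `φ` (well defined: `φ` kills `∂Cₙ₊₁ + Cₙ(A)`);
* `relSingularCohomology_le_span_of_cyclic` — **`Hᵐ⁺¹(X, A; R)` is generated by one class** when
  `R` is a principal ideal domain, `Hₘ(X, A; R)` is projective and `Hₘ₊₁(X, A; R)` is generated by
  one element: with `J = {ℓ(θ)} = R g` the ideal of values on the generator and `ℓ_g(θ) = g`, the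
  class of a relative cocycle representing `ℓ_g` generates.

Consumer: the purity step of the Kollár barrier (`Barriers/HodgeConjecture/IntegralCoefficientsCurvePurity`,
`…CurveSemipurity`): there `H₃(U, U ∖ S; ℤ) = 0` is proved, so the cyclicity of `H⁴(U, U ∖ S; ℤ)`
asked for follows from the cyclicity of the relative HOMOLOGY `H₄(U, U ∖ S; ℤ)` (the Thom class).
Everything is proved; no definitions, no named facts.

## References

* [HatcherAT2002] A. Hatcher, Algebraic Topology, CUP 2002, §3.1 Thm. 3.2 (p. 195), pp. 197,
  199–200; §2.1 p. 115 (relative cycles and boundaries).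
-/

noncomputable section

-- as in `RelativeCochainsKronecker`: chains of the concrete complex are `Finsupp`s up to unfolding
-- of semireducible definitions
set_option backward.isDefEq.respectTransparency false

open CategoryTheory Limits

universe u v

namespace Literature.AlgebraicTopology.SingularHomology

variable {R : Type v} [CommRing R] {X : Type u} [TopologicalSpace X] {A : Set X}

open singularCochainComplex

/-! ### Cochains are linear in the cochain -/

/-- Evaluation of chains is additive in the cochain (pointwise). [folklore] -/
theorem linearCombination_sub_family {n : ℕ} (φ ψ : SingularSimplex X n → R) (x : CChain R X n) :
    Finsupp.linearCombination R (φ - ψ) x =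
      Finsupp.linearCombination R φ x - Finsupp.linearCombination R ψ x := by
  simp only [Finsupp.linearCombination_apply, Pi.sub_apply, smul_eq_mul, mul_sub, Finsupp.sum_sub]

/-- Evaluation of chains is homogeneous in the cochain (pointwise). [folklore] -/
theorem linearCombination_smul_family {n : ℕ} (r : R) (φ : SingularSimplex X n → R)
    (x : CChain R X n) :
    Finsupp.linearCombination R (r • φ) x = r * Finsupp.linearCombination R φ x := by
  simp only [Finsupp.linearCombination_apply, Pi.smul_apply, smul_eq_mul, Finsupp.mul_sum]
  exact Finsupp.sum_congr fun σ _ ↦ by ring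

/-! ### The functional of a relative cocycle -/

/-- **A relative cocycle defines a functional on `Hₙ(C(X)/C(A))`, `[x] ↦ φ(x)`** (Hatcher 2002,
§3.1, the Kronecker map for the pair, p. 199): `φ` vanishes on the simplices of `A` and, being a
cocycle, on the boundaries `∂Cₙ₊₁`, hence on the relative boundaries `∂Cₙ₊₁ + Cₙ(A)`, the kernel
of the class map `relZ → Hₙ` (`relClsₗ_eq_zero_iff`). [cite: HatcherAT2002, §3.1 p. 199 and §2.1 p. 115] -/
theorem exists_linearMap_of_relCocycle {n : ℕ} (φ : SingularSimplex X n → R)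
    (hφ : φ ∈ relCochains R R A n) (hd : (singularCochainComplex R R X).d n (n + 1) φ = 0) :
    ∃ ℓ : (chainsInSub R R X A).quotient.homology n →ₗ[R] R,
      ∀ (x : CChain R X n) (hx : x ∈ relZ R A n),
        ℓ (relClsₗ R A n ⟨x, hx⟩) = Finsupp.linearCombination R φ x := by
  -- `φ` on the relative cycles
  let f : relZ R A n →ₗ[R] R := Finsupp.linearCombination R φ ∘ₗ (relZ R A n).subtype
  -- kills the relative boundaries
  have hker : LinearMap.ker (relClsₗ R A n) ≤ LinearMap.ker f := by
    intro z hz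
    rw [LinearMap.mem_ker, relClsₗ_eq_zero_iff] at hz
    obtain ⟨b, ⟨w, rfl⟩, a, ha, hba⟩ := Submodule.mem_sup.mp hz
    rw [LinearMap.mem_ker]
    change Finsupp.linearCombination R φ (z.1 : CChain R X n) = 0
    rw [← hba, map_add, linearCombination_eq_zero_of_mem_chainsIn hφ ha, add_zero]
    rcases n with _ | n
    · -- no boundaries into degree `0`... `∂ : C₁ → C₀`: `w : C₁`
      change Finsupp.linearCombination R φ ((csingularChainComplex R R X).d (0 + 1) 0 w) = 0
      rw [linearCombination_d, hd, Finsupp.linearCombination_zero, LinearMap.zero_apply]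
    · change Finsupp.linearCombination R φ ((csingularChainComplex R R X).d (n + 1 + 1) (n + 1) w) = 0
      rw [linearCombination_d, hd, Finsupp.linearCombination_zero, LinearMap.zero_apply]
  -- descend along the surjection `relClsₗ`
  refine ⟨(LinearMap.ker (relClsₗ R A n)).liftQ f hker ∘ₗ
    (LinearMap.quotKerEquivOfSurjective (relClsₗ R A n) relClsₗ_surjective).symm.toLinearMap,
    fun x hx ↦ ?_⟩
  have h1 : (LinearMap.quotKerEquivOfSurjective (relClsₗ R A n) relClsₗ_surjective).symm
      (relClsₗ R A n ⟨x, hx⟩) = Submodule.Quotient.mk ⟨x, hx⟩ := by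
    rw [LinearEquiv.symm_apply_eq, LinearMap.quotKerEquivOfSurjective_apply_mk]
  rw [LinearMap.comp_apply, LinearEquiv.coe_toLinearMap, h1, Submodule.liftQ_apply]
  rfl

/-! ### The cyclic case of Kronecker duality for pairs -/

section PID

variable [IsDomain R] [IsPrincipalIdealRing R]

/-- **`Hₘ₊₁(X, A; R)` cyclic and `Hₘ(X, A; R)` projective imply `Hᵐ⁺¹(X, A; R)` cyclic**, `R` a
principal ideal domain (Hatcher 2002, Thm. 3.2 for the relative complex, p. 195 with pp. 197,
199–200: `Hᵐ⁺¹(X, A; R) ≅ Hom(Hₘ₊₁(X, A), R) ⊕ Ext(Hₘ(X, A), R)` and `Ext = 0`). Hypotheses in the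
concrete model `H(C(X)/C(A))` (as in `isZero_relSingularCohomology_succ_of_projective`); conclusion for
the tree's `relSingularCohomology`. Proof: the values `ℓ(θ)` of the functionals on the generator
form an ideal `R g`; a relative cocycle `φ_g` representing `ℓ_g` with `ℓ_g(θ) = g`
(`exists_relCocycle_of_linearMap`) has a class generating `Hᵐ⁺¹(X, A; R)`: any relative cocycle `φ`
has `ℓ_φ = r ℓ_g` for some `r`, so `φ - r φ_g` kills the relative cycles and is a relative
coboundary (`exists_rel_d_eq_of_kill`). [cite: HatcherAT2002, §3.1 Thm. 3.2 (p. 195), p. 197 and pp. 199–200] -/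
theorem relSingularCohomology_le_span_of_cyclic {m : ℕ}
    (hproj : Module.Projective R ((chainsInSub R R X A).quotient.homology m))
    (θ : (chainsInSub R R X A).quotient.homology (m + 1))
    (hθ : ∀ y, y ∈ Submodule.span R ({θ} : Set ((chainsInSub R R X A).quotient.homology (m + 1)))) :
    ∃ Θ : relSingularCohomology R R X A (m + 1),
      ∀ c, c ∈ Submodule.span R ({Θ} : Set (relSingularCohomology R R X A (m + 1))) := by
  classical
  -- the ideal of values on the generator
  let ev : ((chainsInSub R R X A).quotient.homology (m + 1) →ₗ[R] R) →ₗ[R] R := LinearMap.applyₗ θ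
  let J : Submodule R R := LinearMap.range ev
  obtain ⟨g, hg⟩ := (IsPrincipalIdealRing.principal J).principal
  have hgJ : g ∈ J := by rw [hg]; exact Submodule.mem_span_singleton_self g
  obtain ⟨ℓg, hℓg⟩ := LinearMap.mem_range.1 hgJ
  have hℓgθ : ℓg θ = g := hℓg
  -- a relative cocycle representing `ℓ_g`, and its class `Θ`
  obtain ⟨φg, hφg, hdφg, hφgev⟩ := exists_relCocycle_of_linearMap (A := A) ℓg
  have hdz : (relCochainComplex R R A).d (m + 1) (m + 1 + 1) (relCochainComplex.mk φg hφg) = 0 :=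
    relCochainComplex.val_injective (by
      rw [relCochainComplex.val_d', relCochainComplex.val_mk, hdφg, relCochainComplex.val_zero])
  let zg : (relCochainComplex R R A).cycles (m + 1) :=
    (relCochainComplex R R A).cyclesMk (relCochainComplex.mk φg hφg) (m + 1 + 1) (by simp) hdz
  refine ⟨relSingularCohomology.π R R X A (m + 1) zg, fun c ↦ ?_⟩
  -- an arbitrary class `c = [z]`, `φ = val z`
  obtain ⟨z, rfl⟩ := (ModuleCat.epi_iff_surjective (relSingularCohomology.π R R X A (m + 1))).1
    inferInstance c
  set φ : SingularSimplex X (m + 1) → R :=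
    relCochainComplex.val ((relCochainComplex R R A).iCycles (m + 1) z) with hφdef
  have hφ : φ ∈ relCochains R R A (m + 1) := relCochainComplex.val_mem _
  have hdφ : (singularCochainComplex R R X).d (m + 1) (m + 1 + 1) φ = 0 := by
    have h1 : (relCochainComplex R R A).d (m + 1) (m + 1 + 1)
        ((relCochainComplex R R A).iCycles (m + 1) z) = 0 := by
      rw [← ModuleCat.comp_apply, HomologicalComplex.iCycles_d]; rfl
    rw [hφdef, ← relCochainComplex.val_d', h1, relCochainComplex.val_zero]
  -- its functional is `r • ℓ_g`
  obtain ⟨ℓ, hℓ⟩ := exists_linearMap_of_relCocycle φ hφ hdφ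
  have hℓθ : ℓ θ ∈ J := LinearMap.mem_range.2 ⟨ℓ, rfl⟩
  rw [hg] at hℓθ
  obtain ⟨r, hr⟩ := Submodule.mem_span_singleton.1 hℓθ
  have hℓeq : ℓ = r • ℓg := by
    refine LinearMap.ext fun y ↦ ?_
    obtain ⟨s, rfl⟩ := Submodule.mem_span_singleton.1 (hθ y)
    rw [map_smul, LinearMap.smul_apply, map_smul, hℓgθ, ← hr, smul_eq_mul, smul_eq_mul,
      smul_eq_mul, smul_eq_mul]
    ring
  -- `φ - r φ_g` kills the relative cycles, hence is a relative coboundary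
  have hkill : ∀ x : CChain R X (m + 1), x ∈ relZ R A (m + 1) →
      Finsupp.linearCombination R (φ - r • φg) x = 0 := by
    intro x hx
    rw [linearCombination_sub_family, linearCombination_smul_family, ← hℓ x hx, hφgev x hx, hℓeq,
      LinearMap.smul_apply, smul_eq_mul, sub_self]
  obtain ⟨ψ, hψ, hdψ⟩ := exists_rel_d_eq_of_kill (A := A) hproj (φ - r • φg) hkill
  -- so `[z] = r • Θ`
  refine Submodule.mem_span_singleton.2 ⟨r, ?_⟩
  rw [eq_comm, ← sub_eq_zero, ← map_smul, ← map_sub]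
  change relSingularCohomology.π R R X A (m + 1) (z - r • zg) = 0
  rw [relSingularCohomology.π_eq_zero_iff, CochainComplex.prev_nat_succ]
  refine ⟨relCochainComplex.mk ψ hψ, relCochainComplex.val_injective ?_⟩
  rw [relCochainComplex.val_d', relCochainComplex.val_mk, hdψ, map_sub, map_smul]
  change φ - r • φg = relCochainComplex.val ((relCochainComplex R R A).iCycles (m + 1) z) -
    r • relCochainComplex.val ((relCochainComplex R R A).iCycles (m + 1) zg)
  rw [← hφdef]
  congr 1
  -- the underlying cochain of the generator's cocycle is `φ_g`
  have hval : relCochainComplex.val ((relCochainComplex R R A).iCycles (m + 1) zg) = φg := by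
    have h := (relCochainComplex R R A).i_cyclesMk (relCochainComplex.mk φg hφg) (m + 1 + 1)
      (by simp) hdz
    exact congrArg relCochainComplex.val h
  show r • φg = r • relCochainComplex.val ((relCochainComplex R R A).iCycles (m + 1) zg)
  rw [hval]

end PID

end Literature.AlgebraicTopology.SingularHomology

end
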